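import Summits.QuantumAdvantage.QuantumAdvantage.Theorems.MobiusLadderLiouvilleOrthogonalTC0SensLtf
import Summits.QuantumAdvantage.QuantumAdvantage.Theorems.MobiusLadderLiouvilleOrthogonalTC0StubSizeKSens
import Summits.QuantumAdvantage.QuantumAdvantage.Theorems.MobiusLadderLiouvilleOrthogonalTC0Spectral
import HarnessLib

/-!
# Crux `MobiusLadder.LiouvilleOrthogonalTC0` (stmt-QuantumAdvantage-1393): the bounded-size rung —
`λ` is orthogonal to every threshold circuit with a bounded number of gates (any depth, unbounded
fan-in), unconditionally

Line `Sketch`, skeleton v5 (lead `prover-line-stmt-QuantumAdvantage-1393-c2-0`). A circuit over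
`tcBasis` (`∧ₖ`, `∨ₖ`, `¬`, `MAJₖ` of any fan-in) with at most `K` gates has block sensitivity at most
`3^K · 2ⁿ √m` for every `m`-partition of the variables (`stub_sizeK_sens`: every gate is a threshold of
an affine form in the inputs plus the values of earlier gates, hence one of `2^{#earlier gates}`
integer threshold functions of the inputs selected by those values; threshold functions have block
sensitivity `≤ 2ⁿ √m`, `stub_sensLtf`), so by Peres' conclusion (`stub_tailOfSens`) its Fourier tail
above level `m` is `≤ 3^{K+1}/√m`, uniformly in `n`; the spectral criterion `stub_spectral`
(Bourgain's uniform Möbius–Walsh bound + Green's §2 deduction) finishes.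

* `tailWeight_circuit_size_le` — `W^{≥ m}[sgn ∘ C] ≤ 3^{K+1}/√m` for `C` over `tcBasis`, `size ≤ K`, `m ≥ 1`;
* `liouville_orthogonal_size_le` — for every `K` and `ε > 0`, eventually in `n`, every circuit over
  `tcBasis` on `n` digits with `size ≤ K` has `|Σ_{N<2ⁿ} λ(N) sgn C(bits N)| ≤ ε 2ⁿ`;
* `LiouvilleOrthogonalTC0_size_const` — the crux `LiouvilleOrthogonalTC0` for CONSTANT size
  polynomials `p` (every depth `d`), verbatim in the crux's shape.

Together with the depth-one rung (`…DepthOne.lean`) and the `AC⁰` rung (`LiouvilleOrthogonalAC0_proof`)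
this leaves, as the open residue of the line, circuits of depth `≥ 2` containing a majority gate and of
size growing with `n` (`stub_hyp_pos`).
-/

set_option linter.dupNamespace false -- D-0017: single-problem summit ⇒ `QuantumAdvantage.QuantumAdvantage` by design

noncomputable section

namespace Summit.QuantumAdvantage.QuantumAdvantage.Theorems.LiouvilleOrthogonalTC0

open Filter Finset Topology
open Literature.Computability.Complexity
open Literature.Computability.Complexity.LowDegree (tailWeight tailWeight_le_one)
open Literature.Probability.RandomGraphs.LowDegree (sgn)

/-- **Fourier tails of bounded-size threshold circuits.** A circuit over `tcBasis` with at most `K`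
gates has `W^{≥ m}[sgn ∘ C] ≤ 3^{K+1}/√m` for every `m ≥ 1`, uniformly in the number of inputs. -/
theorem tailWeight_circuit_size_le {n : ℕ} (K : ℕ) (C : Circuit (Fin n)) (hB : C.IsOver tcBasis)
    (hs : C.size ≤ K) {m : ℕ} (hm : 1 ≤ m) :
    tailWeight (fun x : Fin n → Bool => sgn (C.eval x)) m ≤ (3 : ℝ) ^ (K + 1) / Real.sqrt m := by
  have hmpos : (0 : ℝ) < m := Nat.cast_pos.2 (by omega)
  have hs0 : 0 < Real.sqrt m := Real.sqrt_pos.2 hmpos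
  by_cases hm9 : m ≤ 9
  · -- small `m`: `W^{≥m} ≤ 1 ≤ 3^{K+1}/√m`
    have h1 : tailWeight (fun x : Fin n → Bool => sgn (C.eval x)) m ≤ 1 :=
      tailWeight_le_one (fun x => by cases C.eval x <;> simp) m
    refine h1.trans ?_
    rw [le_div_iff₀ hs0, one_mul]
    calc Real.sqrt m ≤ Real.sqrt ((3 : ℝ) ^ 2) :=
          Real.sqrt_le_sqrt (by norm_num; exact_mod_cast hm9)
      _ = 3 := Real.sqrt_sq (by norm_num)
      _ ≤ (3 : ℝ) ^ (K + 1) := by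
          calc (3 : ℝ) = 3 ^ 1 := (pow_one _).symm
            _ ≤ 3 ^ (K + 1) := pow_le_pow_right₀ (by norm_num) (by omega)
  · have hm10 : 10 ≤ m := by omega
    have h := stub_tailOfSens hm10 (B := (3 : ℝ) ^ K) (fun x => C.eval x)
      (fun π => stub_sizeK_sens K C hB hs hm π)
    calc tailWeight (fun x : Fin n → Bool => sgn (C.eval x)) m ≤ 3 * (3 : ℝ) ^ K / Real.sqrt m := h
      _ = (3 : ℝ) ^ (K + 1) / Real.sqrt m := by rw [pow_succ]; ring

/-- **`λ` is orthogonal to every bounded-size threshold circuit** (unconditional): for every `K`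
and `ε > 0`, for all sufficiently large `n`, every circuit `C` on the `n` binary digits over `tcBasis`
with at most `K` gates (any depth, any fan-in) satisfies `|Σ_{N<2ⁿ} λ(N) · sgn (C(bits N))| ≤ ε · 2ⁿ`. -/
theorem liouville_orthogonal_size_le (K : ℕ) : ∀ ε : ℝ, 0 < ε → ∀ᶠ n : ℕ in atTop,
    ∀ C : Circuit (Fin n), C.IsOver tcBasis → C.size ≤ K →
      |∑ N ∈ Finset.range (2 ^ n), ((ArithmeticFunction.liouville N : ℤ) : ℝ) *
          sgn (C.eval (fun i : Fin n => Nat.testBit N i))| ≤ ε * (2 : ℝ) ^ n := by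
  intro ε hε
  have hτ : Tendsto (fun m : ℕ => (3 : ℝ) ^ (K + 1) / Real.sqrt m) atTop (𝓝 0) :=
    tendsto_const_nhds.div_atTop (Real.tendsto_sqrt_atTop.comp tendsto_natCast_atTop_atTop)
  filter_upwards [stub_spectral (fun m : ℕ => (3 : ℝ) ^ (K + 1) / Real.sqrt m) hτ ε hε]
    with n hn C hB hs
  exact hn (fun y => C.eval y) (fun m hm => tailWeight_circuit_size_le K C hB hs hm)

/-- **The crux `LiouvilleOrthogonalTC0` for constant size polynomials, verbatim** (unconditional):
if `p` is a constant polynomial then for every depth `d` and `ε > 0`, eventually in `n`, every circuit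
over `tcBasis` with `acDepth ≤ d` and `size ≤ p(n)` has `|Σ_{N<2ⁿ} λ(N) · sgn (C(bits N))| ≤ ε · 2ⁿ`. -/
theorem LiouvilleOrthogonalTC0_size_const (d : ℕ) (p : Polynomial ℕ) (hp : p.natDegree = 0) :
    ∀ ε : ℝ, 0 < ε → ∀ᶠ n : ℕ in Filter.atTop,
      ∀ C : Literature.Computability.Complexity.Circuit (Fin n),
        C.IsOver Literature.Computability.Complexity.tcBasis → C.acDepth ≤ d → C.size ≤ p.eval n →
          |∑ N ∈ Finset.range (2 ^ n), ((ArithmeticFunction.liouville N : ℤ) : ℝ) *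
              Literature.Probability.RandomGraphs.LowDegree.sgn
                (C.eval (fun i : Fin n => Nat.testBit N i))| ≤ ε * (2 : ℝ) ^ n := by
  intro ε hε
  filter_upwards [liouville_orthogonal_size_le (p.coeff 0) ε hε] with n hn C hB _ hs
  rw [Polynomial.eq_C_of_natDegree_eq_zero hp, Polynomial.eval_C] at hs
  exact hn C hB hs

/-- **Registered stub `stub_sizeLe`**: verbatim `liouville_orthogonal_size_le`. -/
theorem stub_sizeLe (K : ℕ) : ∀ ε : ℝ, 0 < ε → ∀ᶠ n : ℕ in atTop, ∀ C : Circuit (Fin n), C.IsOver tcBasis → C.size ≤ K → |∑ N ∈ Finset.range (2 ^ n), ((ArithmeticFunction.liouville N : ℤ) : ℝ) * sgn (C.eval (fun i : Fin n => Nat.testBit N i))| ≤ ε * (2 : ℝ) ^ n :=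
  liouville_orthogonal_size_le K

end Summit.QuantumAdvantage.QuantumAdvantage.Theorems.LiouvilleOrthogonalTC0
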